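import Literature.AlgebraicTopology.FundamentalGroup.TorusMinusFiniteAlignment
import Literature.AlgebraicTopology.FundamentalGroup.PuncturedTorusFundamentalGroup
import HarnessLib

/-!
# The fundamental group of the torus minus `n ≥ 1` points is free of rank `n + 1`

Topic `Literature/AlgebraicTopology/FundamentalGroup`.  For the real torus `T = (ℝ/ℤ)^ι` with EXACTLY
two indices `i₀ ≠ i₁` (the tree's model `ι → AddCircle 1`; as a space the tree's `ComplexTorus Φ`, so
this is the topological type of an elliptic curve over `ℂ` minus finitely many points — the hyperbolic
curves of type `(1, r)`) and a finite non-empty `S ⊆ T`: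

> **`π₁(T ∖ S, y) ≅ F_{|S|+1}`** for every base point `y` —
> `TorusMinusFinite.nonempty_mulEquiv_freeGroup_compl_finite`

(A. Hatcher, *Algebraic Topology* (2002), §1.2, Example 1.22 and the discussion following Thm. 1.20:
a closed surface minus `n ≥ 1` points deformation retracts onto a wedge of circles — for the torus a
wedge of `n + 1` circles — whose fundamental group is free by van Kampen's theorem.)  PROOF (van Kampen
applied directly, as in the tree's once-punctured case `PuncturedTorusFundamentalGroup.lean`, after an
ALIGNMENT of the punctures): by `TorusMinusFinite.exists_homeomorph_forall_apply_eq` a self-homeomorphism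
of `T` puts all of `S` on one horizontal circle `H = {p | p i₁ = c}`, with pairwise distinct abscissae;
fix `s₀ ∈ S` and the vertical circle `W = {p | p i₀ = s₀ i₀}`.  Then `T ∖ S = U ∪ V` with `U = T ∖ H`
(a slit torus, `π₁ ≅ F₁`, `PuncturedTorus.nonempty_mulEquiv_freeGroup_coordNe`) and
`V = T ∖ (W ∪ S) = (T ∖ W) ∖ (S ∖ {s₀})`, a slit torus minus `|S| - 1` points, which polar coordinates
identify with the unit disc minus `|S|` points (`TorusMinusFinite.nonempty_homeomorph_coordNe_ball_diff`),
of `π₁ ≅ F_{|S|}` by the tree's planar theorem `nonempty_mulEquiv_freeGroup_of_convex`; and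
`U ∩ V = T ∖ (H ∪ W)` is the open square, simply connected (`PuncturedTorus.isSimplyConnected_forall_ne`).
The free-product form of van Kampen's theorem (`VanKampen.fundamentalGroupEquivCoprod`) gives
`π₁(T ∖ S) ≅ F₁ ∗ F_{|S|} ≅ F_{|S|+1}`.

* `TorusMinusFinite.exists_homeomorph_coordNe_diff_ball_diff`, `…isPathConnected_coordNe_diff`,
  `…nonempty_mulEquiv_freeGroup_coordNe_diff` — the slit torus minus a finite set: homeomorphic to the
  disc minus a finite set, path connected, `π₁` free of rank `|S'| + 1`;
* `TorusMinusFinite.nonempty_mulEquiv_freeGroup_compl_of_aligned` — the aligned case;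
* `TorusMinusFinite.isPathConnected_compl_finite`, `…pathConnectedSpace_compl_finite`,
  **`TorusMinusFinite.nonempty_mulEquiv_freeGroup_compl_finite`** — the theorem.

Proof-only: no definitions, no instances, no named facts.  Classical; it supplies the abc-iut cell's
campaign-L geometric column with «`π₁(E ∖ S)` free of rank `|S| + 1`» for every type `(1, r)` (slimness
of `π̂₁`, freeness of the Möbius deck group); nothing here bears on [IUTchIII] Cor. 3.12.

## References
* A. Hatcher, *Algebraic Topology*, CUP (2002), §1.2 Thm. 1.20, Example 1.22 (p. 51). [HatcherAT2002]
-/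

noncomputable section

open Set Function
open scoped Topology

namespace Literature.AlgebraicTopology.FundamentalGroup

namespace TorusMinusFinite

variable {ι : Type*} [DecidableEq ι] {i₀ i₁ : ι}

/-! ### §1 The slit torus minus a finite set -/

/-- **The slit torus minus a finite set is the unit disc minus a finite set**: for `S'` finite inside
`{p | p i₀ ≠ a}` there is a finite `F ⊆ 𝔻` with `|F| = |S'| + 1` (the images of `S'` and the centre)
and a homeomorphism `{p | p i₀ ≠ a} ∖ S' ≃ₜ 𝔻 ∖ F` (restriction of the polar-coordinate homeomorphism
`nonempty_homeomorph_coordNe_ball_diff`). [cite: HatcherAT2002, §1.2 Example 1.22 (method)] -/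
theorem exists_homeomorph_coordNe_diff_ball_diff (hne : i₀ ≠ i₁) (hι : ∀ i, i = i₀ ∨ i = i₁)
    (a : AddCircle (1 : ℝ)) {S' : Set (ι → AddCircle (1 : ℝ))} (hS' : S'.Finite)
    (hS'a : ∀ s ∈ S', s i₀ ≠ a) :
    ∃ F : Set ℂ, F.Finite ∧ F ⊆ Metric.ball (0 : ℂ) 1 ∧ F.ncard = S'.ncard + 1 ∧
      Nonempty (↥({p : ι → AddCircle (1 : ℝ) | p i₀ ≠ a} \ S') ≃ₜ ↥(Metric.ball (0 : ℂ) 1 \ F)) := by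
  classical
  obtain ⟨Ξ⟩ := nonempty_homeomorph_coordNe_ball_diff hne hι a
  set W : Set (ι → AddCircle (1 : ℝ)) := {p | p i₀ ≠ a} with hW
  -- the punctures seen in the slit torus and their images in the punctured disc
  set SW : Set W := Subtype.val ⁻¹' S' with hSW
  let f : W → ℂ := fun w => (Ξ w : ℂ)
  have hf : Injective f := fun w w' h => Ξ.injective (Subtype.ext h)
  set F' : Set ℂ := f '' SW with hF'
  have hSWfin : SW.Finite := hS'.preimage Subtype.val_injective.injOn
  have hF'fin : F'.Finite := hSWfin.image f
  have hF'0 : (0 : ℂ) ∉ F' := by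
    rintro ⟨w, -, hw⟩
    exact (Ξ w).2.2 hw
  have hF'ball : F' ⊆ Metric.ball (0 : ℂ) 1 := by
    rintro _ ⟨w, -, rfl⟩; exact (Ξ w).2.1
  have hSWcard : SW.ncard = S'.ncard := by
    refine Set.ncard_preimage_of_injective_subset_range Subtype.val_injective ?_
    intro s hs
    exact ⟨⟨s, hS'a s hs⟩, rfl⟩
  refine ⟨insert 0 F', hF'fin.insert 0, Set.insert_subset (Metric.mem_ball_self one_pos) hF'ball,
    by rw [Set.ncard_insert_of_notMem hF'0 hF'fin, Set.ncard_image_of_injective _ hf, hSWcard], ?_⟩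
  -- the homeomorphism, in three steps
  let e₁ : ↥(W \ S') ≃ₜ {w : W // (w : ι → AddCircle (1 : ℝ)) ∉ S'} :=
    (subtypeSubtypeHomeomorph W fun p => p ∉ S').symm
  have hiff : ∀ w : W, (w : ι → AddCircle (1 : ℝ)) ∉ S' ↔ (Ξ w : ℂ) ∉ F' := by
    intro w
    constructor
    · rintro hw ⟨w', hw', h⟩
      exact hw (by rw [← hf h]; exact hw')
    · intro hw h
      exact hw ⟨w, h, rfl⟩
  let e₂ : {w : W // (w : ι → AddCircle (1 : ℝ)) ∉ S'} ≃ₜ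
      {z : ↥(Metric.ball (0 : ℂ) 1 \ {0}) // (z : ℂ) ∉ F'} := Ξ.subtype hiff
  have hset : {z : ℂ | z ∈ Metric.ball (0 : ℂ) 1 \ {0} ∧ z ∉ F'} = Metric.ball (0 : ℂ) 1 \ insert 0 F' := by
    ext z
    simp only [mem_setOf_eq, mem_sdiff, mem_insert_iff, mem_singleton_iff, not_or]
    tauto
  let e₃ : {z : ↥(Metric.ball (0 : ℂ) 1 \ {0}) // (z : ℂ) ∉ F'} ≃ₜ ↥(Metric.ball (0 : ℂ) 1 \ insert 0 F') :=
    (subtypeSubtypeHomeomorph (Metric.ball (0 : ℂ) 1 \ {0}) fun z => z ∉ F').trans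
      (Homeomorph.setCongr hset)
  exact ⟨e₁.trans (e₂.trans e₃)⟩

/-- **The slit torus minus a finite set is path connected** (it is a disc minus finitely many
points, `isPathConnected_convex_diff_finite`). [cite: HatcherAT2002, §1.2 Example 1.22 (method)] -/
theorem isPathConnected_coordNe_diff (hne : i₀ ≠ i₁) (hι : ∀ i, i = i₀ ∨ i = i₁)
    (a : AddCircle (1 : ℝ)) {S' : Set (ι → AddCircle (1 : ℝ))} (hS' : S'.Finite)
    (hS'a : ∀ s ∈ S', s i₀ ≠ a) :
    IsPathConnected ({p : ι → AddCircle (1 : ℝ) | p i₀ ≠ a} \ S') := by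
  obtain ⟨F, hF, -, -, ⟨e⟩⟩ := exists_homeomorph_coordNe_diff_ball_diff hne hι a hS' hS'a
  -- the disc is infinite, so the disc minus finitely many points is nonempty and path connected
  have hball : (Metric.ball (0 : ℂ) 1).Infinite := by
    have h1 : ((fun t : ℝ => (t : ℂ)) '' Set.Ioo (0 : ℝ) 1).Infinite :=
      (Set.Ioo_infinite zero_lt_one).image Complex.ofReal_injective.injOn
    refine h1.mono ?_
    rintro _ ⟨t, ht, rfl⟩
    rw [Metric.mem_ball, dist_zero_right, Complex.norm_real, Real.norm_eq_abs, abs_of_pos ht.1]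
    exact ht.2
  have hpc : IsPathConnected (Metric.ball (0 : ℂ) 1 \ F) :=
    isPathConnected_convex_diff_finite (convex_ball (0 : ℂ) 1) Metric.isOpen_ball hF
      (hball.sdiff hF).nonempty
  haveI : PathConnectedSpace ↥(Metric.ball (0 : ℂ) 1 \ F) :=
    isPathConnected_iff_pathConnectedSpace.1 hpc
  have h2 := (pathConnectedSpace_iff_univ.1
    (inferInstance : PathConnectedSpace ↥(Metric.ball (0 : ℂ) 1 \ F))).image e.symm.continuous
  rw [image_univ, e.symm.surjective.range_eq] at h2
  exact isPathConnected_iff_pathConnectedSpace.2 (pathConnectedSpace_iff_univ.2 h2)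

/-- **`π₁` of the slit torus minus a finite set `S'` is free of rank `|S'| + 1`** (the unit disc
minus `|S'| + 1` points, the tree's planar theorem `nonempty_mulEquiv_freeGroup_of_convex`).
[cite: HatcherAT2002, §1.2 Example 1.21] -/
theorem nonempty_mulEquiv_freeGroup_coordNe_diff (hne : i₀ ≠ i₁) (hι : ∀ i, i = i₀ ∨ i = i₁)
    (a : AddCircle (1 : ℝ)) {S' : Set (ι → AddCircle (1 : ℝ))} (hS' : S'.Finite)
    (hS'a : ∀ s ∈ S', s i₀ ≠ a) (y : ↥({p : ι → AddCircle (1 : ℝ) | p i₀ ≠ a} \ S')) :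
    Nonempty (_root_.FundamentalGroup ↥({p : ι → AddCircle (1 : ℝ) | p i₀ ≠ a} \ S') y ≃*
      FreeGroup (Fin (S'.ncard + 1))) := by
  obtain ⟨F, hF, hFball, hcard, ⟨e⟩⟩ := exists_homeomorph_coordNe_diff_ball_diff hne hι a hS' hS'a
  obtain ⟨φ⟩ := nonempty_mulEquiv_freeGroup_of_convex (convex_ball (0 : ℂ) 1) Metric.isOpen_ball
    hF hFball (e y)
  exact ⟨(e.fundamentalGroupMulEquiv rfl).trans (φ.trans (FreeGroup.freeGroupCongr (finCongr hcard)))⟩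

/-! ### §2 The aligned case: van Kampen -/

/-- **The torus minus a finite set of punctures on one horizontal circle is path connected**: it is
the union of the slit torus `T ∖ H` and of the slit torus `T ∖ W` minus the other punctures, both path
connected and meeting. [cite: HatcherAT2002, §1.2 Example 1.22 (setting)] -/
theorem isPathConnected_compl_of_aligned (hne : i₀ ≠ i₁) (hι : ∀ i, i = i₀ ∨ i = i₁)
    {S : Set (ι → AddCircle (1 : ℝ))} (hS : S.Finite) {s₀ : ι → AddCircle (1 : ℝ)} (hs₀ : s₀ ∈ S)
    (hal : ∀ s ∈ S, s i₁ = s₀ i₁) : IsPathConnected (Sᶜ : Set (ι → AddCircle (1 : ℝ))) := by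
  classical
  set b : ι → AddCircle (1 : ℝ) := fun i ↦ s₀ i + ((2⁻¹ : ℝ) : AddCircle (1 : ℝ)) with hb
  have hbi : ∀ i, b i - s₀ i = ((2⁻¹ : ℝ) : AddCircle (1 : ℝ)) := fun i ↦ by simp [hb]
  have hbne : ∀ i, b i ≠ s₀ i := fun i h ↦ PuncturedTorus.half_ne_zero (by rw [← hbi i, h, sub_self])
  have hbS : b ∉ S := fun h ↦ hbne i₁ (hal b h)
  have hS'a : ∀ s ∈ S \ {s₀}, s i₀ ≠ s₀ i₀ := by
    rintro s ⟨hs, hs0⟩ h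
    exact hs0 (mem_singleton_iff.2 (ext_two hι h (hal s hs)))
  have hcov : (Sᶜ : Set (ι → AddCircle (1 : ℝ))) =
      {p | p i₁ ≠ s₀ i₁} ∪ ({p | p i₀ ≠ s₀ i₀} \ (S \ {s₀})) := by
    ext p
    simp only [mem_compl_iff, mem_union, mem_setOf_eq, mem_sdiff, mem_singleton_iff]
    constructor
    · intro hp
      by_cases h1 : p i₁ = s₀ i₁
      · right
        refine ⟨fun h0 => hp ?_, fun h => hp h.1⟩
        rw [ext_two hι h0 h1]; exact hs₀
      · exact Or.inl h1
    · rintro (h | ⟨h, h'⟩) hp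
      · exact h (hal p hp)
      · exact h' ⟨hp, fun h0 => h (by rw [h0])⟩
  rw [hcov]
  exact (PuncturedTorus.isPathConnected_coordNe s₀ i₁).union
    (isPathConnected_coordNe_diff hne hι (s₀ i₀) hS.sdiff hS'a) ⟨b, hbne i₁, hbne i₀, fun h => hbS h.1⟩

/-- **`π₁(T ∖ S) ≅ F_{|S|+1}` when all the punctures lie on one horizontal circle** `{p | p i₁ = s₀ i₁}`
(`s₀ ∈ S`): van Kampen for the cover of `T ∖ S` by `U = T ∖ H` (slit torus, `π₁ ≅ F₁`) and
`V = (T ∖ W) ∖ (S ∖ {s₀})`, `W = {p | p i₀ = s₀ i₀}` (slit torus minus `|S| - 1` points, `π₁ ≅ F_{|S|}`),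
meeting in the simply connected open square `T ∖ (H ∪ W)`; then `F₁ ∗ F_{|S|} ≅ F_{|S|+1}` and a change of
base point. [cite: HatcherAT2002, §1.2 Example 1.22 (p. 51); Thm. 1.20] -/
theorem nonempty_mulEquiv_freeGroup_compl_of_aligned (hne : i₀ ≠ i₁) (hι : ∀ i, i = i₀ ∨ i = i₁)
    {S : Set (ι → AddCircle (1 : ℝ))} (hS : S.Finite) {s₀ : ι → AddCircle (1 : ℝ)} (hs₀ : s₀ ∈ S)
    (hal : ∀ s ∈ S, s i₁ = s₀ i₁) (y : ↥(Sᶜ)) :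
    Nonempty (_root_.FundamentalGroup ↥(Sᶜ) y ≃* FreeGroup (Fin (S.ncard + 1))) := by
  classical
  -- the base point `b = (s₀ i + ½)ᵢ`, off both circles through `s₀`
  set b : ι → AddCircle (1 : ℝ) := fun i ↦ s₀ i + ((2⁻¹ : ℝ) : AddCircle (1 : ℝ)) with hb
  have hbi : ∀ i, b i - s₀ i = ((2⁻¹ : ℝ) : AddCircle (1 : ℝ)) := fun i ↦ by simp [hb]
  have hbne : ∀ i, b i ≠ s₀ i := fun i h ↦ PuncturedTorus.half_ne_zero (by rw [← hbi i, h, sub_self])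
  have hbS : b ∉ S := fun h ↦ hbne i₁ (hal b h)
  let bY : ↥(Sᶜ) := ⟨b, hbS⟩
  -- the open cover
  let U : Set ↥(Sᶜ) := {q | (q : ι → AddCircle (1 : ℝ)) i₁ ≠ s₀ i₁}
  let V : Set ↥(Sᶜ) := {q | (q : ι → AddCircle (1 : ℝ)) i₀ ≠ s₀ i₀}
  have hUo : IsOpen U :=
    isOpen_ne_fun ((continuous_apply i₁).comp continuous_subtype_val) continuous_const
  have hVo : IsOpen V :=
    isOpen_ne_fun ((continuous_apply i₀).comp continuous_subtype_val) continuous_const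
  have hcov : U ∪ V = univ := by
    refine eq_univ_of_forall fun q ↦ ?_
    by_contra h
    simp only [mem_union, not_or, mem_setOf_eq, not_not, U, V] at h
    exact q.2 (show (q : ι → AddCircle (1 : ℝ)) ∈ S by rw [ext_two hι h.2 h.1]; exact hs₀)
  have hbU : bY ∈ U := hbne i₁
  have hbV : bY ∈ V := hbne i₀
  -- images in `T` of the pieces
  have himU : (Subtype.val '' U) = {p : ι → AddCircle (1 : ℝ) | p i₁ ≠ s₀ i₁} := by
    ext p
    constructor
    · rintro ⟨q, hq, rfl⟩; exact hq
    · intro hp; exact ⟨⟨p, fun h ↦ hp (hal p h)⟩, hp, rfl⟩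
  have himV : (Subtype.val '' V) = {p : ι → AddCircle (1 : ℝ) | p i₀ ≠ s₀ i₀} \ (S \ {s₀}) := by
    ext p
    constructor
    · rintro ⟨q, hq, rfl⟩; exact ⟨hq, fun h ↦ q.2 h.1⟩
    · rintro ⟨hp, hpS⟩
      have hpS' : p ∉ S := fun h ↦ hpS ⟨h, fun h' ↦ hp (by rw [mem_singleton_iff.1 h'])⟩
      exact ⟨⟨p, hpS'⟩, hp, rfl⟩
  have himUV : (Subtype.val '' (U ∩ V)) = {p : ι → AddCircle (1 : ℝ) | ∀ i, p i ≠ s₀ i} := by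
    ext p
    constructor
    · rintro ⟨q, ⟨hqU, hqV⟩, rfl⟩ i
      rcases hι i with rfl | rfl
      · exact hqV
      · exact hqU
    · intro hp
      exact ⟨⟨p, fun h ↦ hp i₁ (hal p h)⟩, ⟨hp i₁, hp i₀⟩, rfl⟩
  have hS'fin : (S \ {s₀}).Finite := hS.sdiff
  have hS'a : ∀ s ∈ S \ {s₀}, s i₀ ≠ s₀ i₀ := by
    rintro s ⟨hs, hs0⟩ h
    exact hs0 (mem_singleton_iff.2 (ext_two hι h (hal s hs)))
  have hUpc : IsPathConnected U := by
    rw [Topology.IsInducing.subtypeVal.isPathConnected_iff, himU]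
    exact PuncturedTorus.isPathConnected_coordNe s₀ i₁
  have hVpc : IsPathConnected V := by
    rw [Topology.IsInducing.subtypeVal.isPathConnected_iff, himV]
    exact isPathConnected_coordNe_diff hne hι (s₀ i₀) hS'fin hS'a
  have hsc : IsSimplyConnected (U ∩ V) := by
    rw [← Topology.IsEmbedding.subtypeVal.isSimplyConnected_image, himUV]
    exact PuncturedTorus.isSimplyConnected_forall_ne s₀
  -- van Kampen, free-product form
  let E₀ := VanKampen.fundamentalGroupEquivCoprod hUo hVo hcov hbU hbV hUpc hVpc hsc
  -- the factor `U ≅ slit torus`, of `π₁ ≅ F₁`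
  let hU : U ≃ₜ ({p : ι → AddCircle (1 : ℝ) | p i₁ ≠ s₀ i₁} : Set _) :=
    { toFun := fun q ↦ ⟨(q : ↥(Sᶜ)), q.2⟩
      invFun := fun p ↦ ⟨⟨p, fun h ↦ p.2 (hal _ h)⟩, p.2⟩
      left_inv := fun q ↦ rfl
      right_inv := fun p ↦ rfl
      continuous_toFun := (continuous_subtype_val.comp continuous_subtype_val).subtype_mk _
      continuous_invFun := (continuous_subtype_val.subtype_mk _).subtype_mk _ }
  obtain ⟨fU⟩ := PuncturedTorus.nonempty_mulEquiv_freeGroup_coordNe hne hι s₀ (w := b) (hbi i₁) (hbne i₁)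
  let eU := (fundamentalGroupEquivOfHomeomorph hU (x := ⟨bY, hbU⟩) (y := ⟨b, hbne i₁⟩) rfl).trans fU
  -- the factor `V ≅ slit torus minus S ∖ {s₀}`, of `π₁ ≅ F_{|S|}`
  let hV : V ≃ₜ ↥({p : ι → AddCircle (1 : ℝ) | p i₀ ≠ s₀ i₀} \ (S \ {s₀})) :=
    { toFun := fun q ↦ ⟨(q : ↥(Sᶜ)), q.2, fun h ↦ (q : ↥(Sᶜ)).2 h.1⟩
      invFun := fun p ↦ ⟨⟨p, fun h ↦ p.2.2 ⟨h, fun h' ↦ p.2.1 (by rw [mem_singleton_iff.1 h'])⟩⟩, p.2.1⟩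
      left_inv := fun q ↦ rfl
      right_inv := fun p ↦ rfl
      continuous_toFun := (continuous_subtype_val.comp continuous_subtype_val).subtype_mk _
      continuous_invFun := (continuous_subtype_val.subtype_mk _).subtype_mk _ }
  obtain ⟨fV⟩ := nonempty_mulEquiv_freeGroup_coordNe_diff hne hι (s₀ i₀) hS'fin hS'a
    ⟨b, hbne i₀, fun h ↦ hbS h.1⟩
  let eV := (fundamentalGroupEquivOfHomeomorph hV (x := ⟨bY, hbV⟩)
    (y := ⟨b, hbne i₀, fun h ↦ hbS h.1⟩) rfl).trans fV
  -- `|S ∖ {s₀}| + 1 = |S|` and `F₁ ∗ F_{|S|} ≅ F_{|S| + 1}`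
  have hcard : (S \ {s₀}).ncard + 1 = S.ncard := Set.ncard_sdiff_singleton_add_one hs₀ hS
  let E := E₀.trans ((MulEquiv.coprodCongr eU eV).trans
    ((freeGroupSumMulEquivCoprod (Fin 1) (Fin ((S \ {s₀}).ncard + 1))).symm.trans
      (FreeGroup.freeGroupCongr (finSumFinEquiv.trans
        (finCongr (show 1 + ((S \ {s₀}).ncard + 1) = S.ncard + 1 by omega))))))
  -- change of base point
  haveI : PathConnectedSpace ↥(Sᶜ) :=
    isPathConnected_iff_pathConnectedSpace.1 (isPathConnected_compl_of_aligned hne hι hS hs₀ hal)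
  exact ⟨(_root_.FundamentalGroup.fundamentalGroupMulEquivOfPathConnected y bY).trans E⟩

/-! ### §3 The general case -/

/-- **The torus minus a finite set is path connected** (align the punctures by a homeomorphism,
`exists_homeomorph_forall_apply_eq`, and use the aligned case). [cite: HatcherAT2002, §1.2 Example 1.22 (setting)] -/
theorem isPathConnected_compl_finite (hne : i₀ ≠ i₁) (hι : ∀ i, i = i₀ ∨ i = i₁)
    {S : Set (ι → AddCircle (1 : ℝ))} (hS : S.Finite) (hSne : S.Nonempty) :
    IsPathConnected (Sᶜ : Set (ι → AddCircle (1 : ℝ))) := by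
  classical
  obtain ⟨s₀, hs₀⟩ := hSne
  obtain ⟨Ψ, hΨ⟩ := exists_homeomorph_forall_apply_eq hne hι hS (0 : AddCircle (1 : ℝ))
  have hal : ∀ s ∈ Ψ '' S, s i₁ = (Ψ s₀) i₁ := by
    rintro _ ⟨s, hs, rfl⟩; rw [hΨ s hs, hΨ s₀ hs₀]
  have key := isPathConnected_compl_of_aligned hne hι (hS.image Ψ) (Set.mem_image_of_mem Ψ hs₀) hal
  have h2 := key.image Ψ.symm.continuous
  have hset : Ψ.symm '' (Ψ '' S)ᶜ = Sᶜ := by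
    rw [Homeomorph.image_symm, Set.preimage_compl, Homeomorph.preimage_image]
  rwa [hset] at h2

/-- The subtype form. [cite: HatcherAT2002, §1.2 Example 1.22 (setting)] -/
theorem pathConnectedSpace_compl_finite (hne : i₀ ≠ i₁) (hι : ∀ i, i = i₀ ∨ i = i₁)
    {S : Set (ι → AddCircle (1 : ℝ))} (hS : S.Finite) (hSne : S.Nonempty) :
    PathConnectedSpace (Sᶜ : Set (ι → AddCircle (1 : ℝ))) :=
  isPathConnected_iff_pathConnectedSpace.1 (isPathConnected_compl_finite hne hι hS hSne)

/-- **The fundamental group of the torus minus `n ≥ 1` points is free of rank `n + 1`** (Hatcher,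
Example 1.22 with Thm. 1.20): for `T = (ℝ/ℤ)^ι` with exactly two indices `i₀ ≠ i₁`, every finite
non-empty `S ⊆ T` and every base point `y ∈ T ∖ S`, `π₁(T ∖ S, y) ≅ F_{|S|+1} = FreeGroup (Fin (|S|+1))`.
Align the punctures on a horizontal circle by a homeomorphism of `T` (`exists_homeomorph_forall_apply_eq`),
transport `π₁` along it, and apply the aligned case `nonempty_mulEquiv_freeGroup_compl_of_aligned`.
[cite: HatcherAT2002, §1.2 Example 1.22 (p. 51); Thm. 1.20] -/
theorem nonempty_mulEquiv_freeGroup_compl_finite (hne : i₀ ≠ i₁) (hι : ∀ i, i = i₀ ∨ i = i₁)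
    {S : Set (ι → AddCircle (1 : ℝ))} (hS : S.Finite) (hSne : S.Nonempty) (y : ↥(Sᶜ)) :
    Nonempty (_root_.FundamentalGroup ↥(Sᶜ) y ≃* FreeGroup (Fin (S.ncard + 1))) := by
  classical
  obtain ⟨s₀, hs₀⟩ := hSne
  obtain ⟨Ψ, hΨ⟩ := exists_homeomorph_forall_apply_eq hne hι hS (0 : AddCircle (1 : ℝ))
  have hal : ∀ s ∈ Ψ '' S, s i₁ = (Ψ s₀) i₁ := by
    rintro _ ⟨s, hs, rfl⟩; rw [hΨ s hs, hΨ s₀ hs₀]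
  -- restriction of `Ψ` to the complements
  let e : ↥(Sᶜ) ≃ₜ ↥((Ψ '' S)ᶜ) :=
    Ψ.subtype fun x => by
      change x ∉ S ↔ Ψ x ∉ Ψ '' S
      rw [Ψ.injective.mem_set_image]
  obtain ⟨φ⟩ := nonempty_mulEquiv_freeGroup_compl_of_aligned hne hι (hS.image Ψ)
    (Set.mem_image_of_mem Ψ hs₀) hal (e y)
  have hcard : (Ψ '' S).ncard = S.ncard := Set.ncard_image_of_injective _ Ψ.injective
  exact ⟨(e.fundamentalGroupMulEquiv rfl).trans
    (φ.trans (FreeGroup.freeGroupCongr (finCongr (by rw [hcard]))))⟩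

end TorusMinusFinite

end Literature.AlgebraicTopology.FundamentalGroup

end
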